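import Summits.ResolutionOfSingularities.ResolutionOfSingularities.Theorems.ValuativeLuAlphaPTorsorTowerModel
import Summits.ResolutionOfSingularities.ResolutionOfSingularities.Theorems.ValuativeLuAlphaPTorsorLocAtCentreDerivations
import Literature.AlgebraicGeometry.Resolution.LocalBlowup

/-!
# A tower member with monomial logarithmic content yields the final forms of the line

Helper file for the line `pfaff-line-log-final-forms` of the crux `Valuative.LuAlphaPTorsor`
(item `stmt-ResolutionOfSingularities-0641`), sub-goals U6/U7 of the lead's skeleton (the G5
assembly step).

Setting: `k ⊆ K` fields, `char k = p`, `O` a valuation ring of `K`, `A₀ ⊆ O` a finitely generated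
`k`-subalgebra of `K`, `t ∈ K` with `t ^ p ∈ A₀`. The registered open stub of the line concludes
with a finitely generated `A₀ ≤ A₁ ⊆ O`, regular at the centre of `O`, together with a regular
system of parameters `u` of `L := Localization.AtPrime (𝔪_O ∩ A₁)`, a set `E` of indices and
exponents `M` such that the *`E`-logarithmic content* of `t ^ p`,
`C_E(t ^ p) := ({δ (t ^ p) | δ ∈ Der_ℤ(L), δ (u_i) ∈ (u_i) ∀ i ∈ E})`, is the monomial ideal
`(∏_{i ∈ E} u_i ^ {M_i})`. Giraud's induction produces these data on a member `R'` of a TOWER of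
local blowing ups (`IsLocalBlowup O`, `LocalBlowup.lean`) of `locAtCentre A₀.toSubring O`, i.e. on
the subring `locAtCentre R' O ⊆ K`. Here the latter is converted into the former:

* `content_eq_span_prod_pow_of_ringEquiv` (U6) — "the `E`-logarithmic content of `a` is
  `(∏ u_i ^ {M_i})`" is transported along a ring isomorphism `e : L ≃ L'` (derivations are
  transported in both directions by `exists_derivation_transport_ringEquiv`);
* `logPrincipalization_of_tower_member` (U7) — `locAtCentre R' O = locAtCentre A₁.toSubring O`
  for a finitely generated `A₀ ≤ A₁ ⊆ O` (`exists_fg_model_of_tower`), and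
  `locAtCentre A₁.toSubring O ≃ Localization.AtPrime (𝔪_O ∩ A₁)` (`locAtCentreEquiv`) is the
  identity on `A₁`; regularity, the regular system of parameters, the dimension and (U6) the
  content are transported along the composite isomorphism.
-/

set_option linter.dupNamespace false

namespace Summit.ResolutionOfSingularities.ResolutionOfSingularities.Theorems.PfaffLine

open IsLocalRing Literature.AlgebraicGeometry.Resolution

/-- **U6, transport of a monomial logarithmic content along a ring isomorphism.** For
`e : L ≃ L'`, elements `u_i` (`i < d`), `E ⊆ {0, …, d-1}`, exponents `M` and `a ∈ L`: if the ideal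
generated by the values `δ a` of the `ℤ`-derivations `δ` of `L` logarithmic along `(u_i)_{i ∈ E}`
is `(∏_{i ∈ E} u_i ^ {M_i})`, then the ideal generated by the values `δ' (e a)` of the
`ℤ`-derivations `δ'` of `L'` logarithmic along `(e u_i)_{i ∈ E}` is `(∏_{i ∈ E} (e u_i) ^ {M_i})`:
the second generating set is the image of the first under `e` (transport of derivations
`δ ↦ e ∘ δ ∘ e⁻¹` in both directions). [folklore] -/
theorem content_eq_span_prod_pow_of_ringEquiv : ∀ {L L' : Type*} [CommRing L] [CommRing L'] [Algebra ℤ L] [Algebra ℤ L'] (e : L ≃+* L') {d : ℕ} (u : Fin d → L) (E : Finset (Fin d)) (M : Fin d → ℕ) (a : L), Ideal.span {b | ∃ δ : Derivation ℤ L L, (∀ i ∈ E, δ (u i) ∈ Ideal.span {u i}) ∧ δ a = b} = Ideal.span {E.prod fun i => u i ^ M i} → Ideal.span {b | ∃ δ' : Derivation ℤ L' L', (∀ i ∈ E, δ' (e (u i)) ∈ Ideal.span {e (u i)}) ∧ δ' (e a) = b} = Ideal.span {E.prod fun i => e (u i) ^ M i} := by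
  intro L L' _ _ _ _ e d u E M a H
  -- the generating set on the `L'`-side is the image under `e` of the one on the `L`-side
  have hS : {b | ∃ δ' : Derivation ℤ L' L', (∀ i ∈ E, δ' (e (u i)) ∈ Ideal.span {e (u i)}) ∧
      δ' (e a) = b} = e '' {b | ∃ δ : Derivation ℤ L L, (∀ i ∈ E, δ (u i) ∈ Ideal.span {u i}) ∧
        δ a = b} := by
    ext b'
    simp only [Set.mem_image, Set.mem_setOf_eq]
    constructor
    · rintro ⟨δ', hlog, rfl⟩
      -- `D := e⁻¹ ∘ δ' ∘ e`
      obtain ⟨D, hD⟩ := exists_derivation_transport_ringEquiv e.symm δ'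
      have hD' : ∀ x, D x = e.symm (δ' (e x)) := fun x => by
        rw [← hD, e.symm_apply_apply]
      refine ⟨D a, ⟨D, fun i hi => ?_, rfl⟩, ?_⟩
      · rw [hD', Ideal.mem_span_singleton]
        have h2 := map_dvd e.symm (Ideal.mem_span_singleton.mp (hlog i hi))
        rwa [e.symm_apply_apply] at h2
      · rw [hD', e.apply_symm_apply]
    · rintro ⟨b, ⟨δ, hlog, rfl⟩, rfl⟩
      -- `D' := e ∘ δ ∘ e⁻¹`
      obtain ⟨D', hD'⟩ := exists_derivation_transport_ringEquiv e δ
      refine ⟨D', fun i hi => ?_, hD' a⟩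
      rw [hD', Ideal.mem_span_singleton]
      exact map_dvd e (Ideal.mem_span_singleton.mp (hlog i hi))
  rw [hS, ← Ideal.map_span e, H, Ideal.map_span e, Set.image_singleton, map_prod]
  simp_rw [map_pow]

/-- **U7, a tower member with monomial logarithmic content gives the final forms.** Let
`A₀ ⊆ O` be a finitely generated `k`-subalgebra (`char k = p`), `t ^ p ∈ A₀`, and `R'` a member
of a tower of local blowing ups of `locAtCentre A₀ O` with respect to `O` such that
`R := locAtCentre R' O` is regular, with a regular system of parameters `u_1, …, u_d`
(`d = dim R`) for which the `E`-logarithmic content of `t ^ p` is `(∏_{i ∈ E} u_i ^ {M_i})`.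
Then there is a finitely generated `A₀ ≤ A₁ ⊆ O`, regular at the centre `𝔭 = 𝔪_O ∩ A₁`, with
the same data on `(A₁)_𝔭` for the image of `t ^ p`: indeed `R = locAtCentre A₁ O ≃ (A₁)_𝔭`
(`exists_fg_model_of_tower`, `locAtCentreEquiv`), an isomorphism which is the identity on `A₁`,
and everything is transported along it (`content_eq_span_prod_pow_of_ringEquiv`). [folklore] -/
theorem logPrincipalization_of_tower_member : ∀ p : ℕ, p.Prime → ∀ (k K : Type) [Field k] [CharP k p] [Field K] [Algebra k K] (O : ValuationSubring K) (A₀ : Subalgebra k K) (h₀ : A₀.toSubring ≤ O.toSubring) (t : K), A₀.FG → ∀ (htp : t ^ p ∈ A₀) (R' : Subring K), Relation.ReflTransGen (Literature.AlgebraicGeometry.Resolution.IsLocalBlowup O) (Literature.AlgebraicGeometry.Resolution.locAtCentre A₀.toSubring O) R' → ∀ [IsRegularLocalRing (Literature.AlgebraicGeometry.Resolution.locAtCentre R' O)] (ht' : t ^ p ∈ Literature.AlgebraicGeometry.Resolution.locAtCentre R' O) {d : ℕ} (u : Fin d → Literature.AlgebraicGeometry.Resolution.locAtCentre R' O) (E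 : Finset (Fin d)) (M : Fin d → ℕ), Ideal.span (Set.range u) = IsLocalRing.maximalIdeal (Literature.AlgebraicGeometry.Resolution.locAtCentre R' O) → ringKrullDim (Literature.AlgebraicGeometry.Resolution.locAtCentre R' O) = (d : WithBot ℕ∞) → Ideal.span {b | ∃ δ : Derivation ℤ (Literature.AlgebraicGeometry.Resolution.locAtCentre R' O) (Literature.AlgebraicGeometry.Resolution.locAtCentre R' O), (∀ i ∈ E, δ (u i) ∈ Ideal.span {u i}) ∧ δ ⟨t ^ p, ht'⟩ = b} = Ideal.span {E.prod fun i => u i ^ M i} → ∃ (A₁ : Subalgebra k K) (h₁ : A₁.toSubring ≤ O.toSubring) (hle : A₀ ≤ A₁), A₁.FG ∧ IsRegularLocalRing (Localization.AtPrime (Ideal.comap (Subring.inclusion h₁) (IsLocalRing.maximalIdeal O))) ∧ ∃ (d : ℕ) (u : Fin d → Localization.AtPrime (Ideal.comap (Subring.inclusion h₁) (IsLocalRing.maximalIdeal O))) (E : Finset (Fin d)) (M : Fin d → ℕ), Ideal.span (Set.range u) = IsLocalRing.maximalIdeal (Localization.AtPrime (Ideal.comap (Subring.inclusion h₁) (IsLocalRing.maximalIdeal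 O))) ∧ ringKrullDim (Localization.AtPrime (Ideal.comap (Subring.inclusion h₁) (IsLocalRing.maximalIdeal O))) = (d : WithBot ℕ∞) ∧ Ideal.span {b | ∃ δ : Derivation ℤ (Localization.AtPrime (Ideal.comap (Subring.inclusion h₁) (IsLocalRing.maximalIdeal O))) (Localization.AtPrime (Ideal.comap (Subring.inclusion h₁) (IsLocalRing.maximalIdeal O))), (∀ i ∈ E, δ (u i) ∈ Ideal.span {u i}) ∧ δ (algebraMap A₁.toSubring (Localization.AtPrime (Ideal.comap (Subring.inclusion h₁) (IsLocalRing.maximalIdeal O))) ⟨t ^ p, hle htp⟩) = b} = Ideal.span {E.prod fun i => u i ^ M i} := by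
  intro p _ k K _ _ _ _ O A₀ h₀ t hfg htp R' hRT _ ht' d u E M hspan hdim hcontent
  -- a finitely generated model `A₀ ≤ A₁ ⊆ O` of the tower member
  obtain ⟨A₁, h₁, hle, hfg₁, hloc⟩ := exists_fg_model_of_tower O A₀ h₀ hfg R' hRT
  -- the ring isomorphism `(A₁)_𝔭 ≃ locAtCentre A₁ O = locAtCentre R' O`, the identity on `A₁`
  obtain ⟨e, he⟩ : ∃ e : Localization.AtPrime (Ideal.comap (Subring.inclusion h₁)
      (IsLocalRing.maximalIdeal O)) ≃+* locAtCentre R' O, ∀ x : A₁.toSubring,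
        ((e (algebraMap A₁.toSubring _ x) : locAtCentre R' O) : K) = x := by
    let e₁ : Localization.AtPrime (Ideal.comap (Subring.inclusion h₁)
        (IsLocalRing.maximalIdeal O)) ≃+* locAtCentre A₁.toSubring O :=
      (locAtCentreEquiv h₁).toRingEquiv
    refine ⟨e₁.trans (RingEquiv.subringCongr hloc), fun x => ?_⟩
    exact congrArg (fun z : locAtCentre A₁.toSubring O => (z : K))
      (AlgEquiv.commutes (locAtCentreEquiv h₁) x)
  have hreg : IsRegularLocalRing
      (Localization.AtPrime (Ideal.comap (Subring.inclusion h₁) (IsLocalRing.maximalIdeal O))) :=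
    IsRegularLocalRing.of_ringEquiv e.symm
  -- the image of `t ^ p ∈ A₁` in `(A₁)_𝔭` corresponds to `t ^ p ∈ locAtCentre R' O`
  have key : algebraMap A₁.toSubring
      (Localization.AtPrime (Ideal.comap (Subring.inclusion h₁) (IsLocalRing.maximalIdeal O)))
        ⟨t ^ p, hle htp⟩ = e.symm ⟨t ^ p, ht'⟩ := by
    rw [RingEquiv.eq_symm_apply]
    exact Subtype.ext (he ⟨t ^ p, hle htp⟩)
  refine ⟨A₁, h₁, hle, hfg₁, hreg, d, e.symm ∘ u, E, M, ?_, ?_, ?_⟩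
  · -- the regular system of parameters
    rw [Set.range_comp, ← Ideal.map_span, hspan, map_ringEquiv_maximalIdeal]
  · -- the dimension
    exact (ringKrullDim_eq_of_ringEquiv e).trans hdim
  · -- the logarithmic content (U6)
    rw [key]
    exact content_eq_span_prod_pow_of_ringEquiv e.symm u E M ⟨t ^ p, ht'⟩ hcontent

end Summit.ResolutionOfSingularities.ResolutionOfSingularities.Theorems.PfaffLine
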